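import Mathlib
import Summits.Ventures.PercRepro2.StarHXhatB
import Summits.Ventures.PercRepro2.StarHCells
import Summits.Ventures.PercRepro2.StarHUnions
import Summits.Ventures.PercRepro2.StarHReadX
import Summits.Ventures.PercRepro2.StarHAlgebra
import Summits.Ventures.PercRepro2.StarOEvAlgMain

/-!
# The mean field `X̂` of the hub in the cells (blind cell PercRepro2, night-1 g11; NIGHT1-G11.md §5;
re-emitted by night-1 g12 on the split StarHXhatA / StarHXhatB)

`Xhat_star_h_cells`: `X̂ = xhatH` — the isolated row `termW {a₃}`, the root rows `P_LH − G_ob`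
(`heavySum`, `PocketConn.sum_T_eq_expect`) and `P_HL − G′_ob`, and the `b`-open rows read on the
outcomes as cells (`XL_pt`, `XH_pt`).
-/

-- generated-style uniform simp sets
set_option linter.unusedSimpArgs false

namespace Summit.Ventures.PercRepro2

open StarGlue PendantRoot

namespace StarH

section XhatCells

variable {V : Type*} {E : Type*} [Fintype E] [DecidableEq E] [Fintype V] [DecidableEq V]
  {R : Type*} [Field R] [LinearOrder R] [IsStrictOrderedRing R]

variable (p : E → R) (ends : E → Sym2 V) {f₁ f₂ f₃ f₄ : E} {a₃ a₁ a₂ o b : V}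

open StarO (pOut viaStar cw prob_viaStar free_viaStar heavySum lightSum)

omit [LinearOrder R] [IsStrictOrderedRing R] in
/-- A row event `outc ∩ A ∩ B ∩ C` with a pointwise reading on the outcome factorises. -/
lemma prob_outc_inter_pt3 (hf₁ : ends f₁ = s(a₃, a₁)) (hf₂ : ends f₂ = s(a₃, a₂))
    (hf₃ : ends f₃ = s(a₃, o)) (hf₄ : ends f₄ = s(a₃, b)) (h12 : f₁ ≠ f₂) (h13 : f₁ ≠ f₃)
    (h14 : f₁ ≠ f₄) (h23 : f₂ ≠ f₃) (h24 : f₂ ≠ f₄) (h34 : f₃ ≠ f₄) (A B C : Set (Config E))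
    (E' : Set (Config E)) (b₁ b₂ b₃ b₄ : Bool)
    (h : ∀ ω ∈ outc₄ f₁ f₂ f₃ f₄ b₁ b₂ b₃ b₄, ω ∈ A ∩ B ∩ C ↔ closeStar ends a₃ ω ∈ E') :
    prob p (outc₄ f₁ f₂ f₃ f₄ b₁ b₂ b₃ b₄ ∩ A ∩ B ∩ C) =
      prob (pOut p ends a₃) E' * cw b₁ (p f₁) * cw b₂ (p f₂) * cw b₃ (p f₃) * cw b₄ (p f₄) := by
  have hf1 : a₃ ∈ ends f₁ := by rw [hf₁]; exact Sym2.mem_mk_left _ _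
  have hf2 : a₃ ∈ ends f₂ := by rw [hf₂]; exact Sym2.mem_mk_left _ _
  have hf3 : a₃ ∈ ends f₃ := by rw [hf₃]; exact Sym2.mem_mk_left _ _
  have hf4 : a₃ ∈ ends f₄ := by rw [hf₄]; exact Sym2.mem_mk_left _ _
  have e : outc₄ f₁ f₂ f₃ f₄ b₁ b₂ b₃ b₄ ∩ A ∩ B ∩ C =
      viaStar ends a₃ E' ∩ outc₄ f₁ f₂ f₃ f₄ b₁ b₂ b₃ b₄ := by
    ext ω
    simp only [Set.mem_inter_iff, viaStar, Set.mem_setOf_eq]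
    constructor
    · rintro ⟨⟨⟨hO, hA⟩, hB⟩, hC⟩
      exact ⟨(h ω hO).1 ⟨⟨hA, hB⟩, hC⟩, hO⟩
    · rintro ⟨hE, hO⟩
      obtain ⟨⟨hA, hB⟩, hC⟩ := (h ω hO).2 hE
      exact ⟨⟨⟨hO, hA⟩, hB⟩, hC⟩
  rw [e, prob_inter_outc₄ p h12 h13 h14 h23 h24 h34 (free_viaStar ends a₃ hf1 _)
    (free_viaStar ends a₃ hf2 _) (free_viaStar ends a₃ hf3 _) (free_viaStar ends a₃ hf4 _),
    prob_viaStar]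

omit [LinearOrder R] [IsStrictOrderedRing R] in
/-- **The mean field of the hub in the cells**: `X̂ = xhatH` with `G_ob = Eprod'`, `X0 = termW {a₃}`. -/
theorem Xhat_star_h_cells (hf₁ : ends f₁ = s(a₃, a₁)) (hf₂ : ends f₂ = s(a₃, a₂))
    (hf₃ : ends f₃ = s(a₃, o)) (hf₄ : ends f₄ = s(a₃, b))
    (hstar : ∀ e, a₃ ∈ ends e → e = f₁ ∨ e = f₂ ∨ e = f₃ ∨ e = f₄)
    (h31 : a₃ ≠ a₁) (h32 : a₃ ≠ a₂) (h3o : a₃ ≠ o) (h3b : a₃ ≠ b) (h12 : f₁ ≠ f₂) (h13 : f₁ ≠ f₃)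
    (h14 : f₁ ≠ f₄) (h23 : f₂ ≠ f₃) (h24 : f₂ ≠ f₄) (h34 : f₃ ≠ f₄) :
    Xhat p ends o a₁ a₂ a₃ b =
      xhatH (prob (pOut p ends a₃) (cLL ends a₁ a₂ o b)) (prob (pOut p ends a₃) (cLH ends a₁ a₂ o b))
        (prob (pOut p ends a₃) (cLN ends a₁ a₂ o b)) (prob (pOut p ends a₃) (cHL ends a₁ a₂ o b))
        (prob (pOut p ends a₃) (cHH ends a₁ a₂ o b)) (prob (pOut p ends a₃) (cHN ends a₁ a₂ o b))
        (PocketConn.Eprod' (pOut p ends a₃) ends o a₁ a₂ b)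
        (PocketConn.Eprod' (pOut p ends a₃) ends o a₂ a₁ b)
        (termW p ends o a₁ a₂ b {a₃}) (p f₁) (p f₂) (p f₃) (p f₄) := by
  rw [Xhat_star_h p ends hf₁ hf₂ hf₃ hf₄ hstar h31 h32 h3o h3b h12 h13 h14 h23 h24 h34]
  set q := pOut p ends a₃ with hq
  have hheavy : heavySum ends q o a₁ a₂ b = prob q (cLH ends a₁ a₂ o b) -
      PocketConn.Eprod' q ends o a₁ a₂ b := by
    unfold heavySum
    rw [PocketConn.sum_T_eq_expect q ends o a₁ a₂ b, PocketConn.expect_FT, ← cLH_eq]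
    congr 2
    ext ω
    simp only [Set.mem_inter_iff, mem_connEvent, Set.mem_compl_iff, avoidAll_eq_compl]
    constructor
    · rintro ⟨⟨h2b, h1o⟩, hQ⟩; exact ⟨⟨fun h => hQ (conn_symm h), h1o⟩, h2b⟩
    · rintro ⟨⟨hQ, h1o⟩, h2b⟩; exact ⟨⟨h2b, h1o⟩, fun h => hQ (conn_symm h)⟩
  have hlight : lightSum ends q o a₁ a₂ b = prob q (cHL ends a₁ a₂ o b) -
      PocketConn.Eprod' q ends o a₂ a₁ b := by
    unfold lightSum
    rw [PocketConn.sum_T_eq_expect q ends o a₂ a₁ b, PocketConn.expect_FT, ← cHL_eq]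
    congr 2
    ext ω
    simp only [Set.mem_inter_iff, mem_connEvent, Set.mem_compl_iff, avoidAll_eq_compl]
    constructor
    · rintro ⟨⟨h1b, h2o⟩, hQ⟩; exact ⟨⟨hQ, h2o⟩, h1b⟩
    · rintro ⟨⟨hQ, h2o⟩, h1b⟩; exact ⟨⟨h1b, h2o⟩, hQ⟩
  rw [hheavy, hlight]
  simp only [Fintype.sum_bool]
  simp only [prob_outc_inter_pt3 p ends hf₁ hf₂ hf₃ hf₄ h12 h13 h14 h23 h24 h34 _ _ _ _ _ _ _ _
      (XL_pt ends hf₁ hf₂ hf₃ hf₄ hstar h31 h32 h3o h3b _ _ _ _),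
    prob_outc_inter_pt3 p ends hf₁ hf₂ hf₃ hf₄ h12 h13 h14 h23 h24 h34 _ _ _ _ _ _ _ _
      (XH_pt ends hf₁ hf₂ hf₃ hf₄ hstar h31 h32 h3o h3b _ _ _ _),
    rdXL, rdXH, ↓reduceIte, Bool.false_eq_true, cw, prob_empty, pu_HL, pu_LH, pu_LH_LN, pu_HL_HN]
  unfold xhatH
  ring

end XhatCells

end StarH

end Summit.Ventures.PercRepro2
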